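import Summits.BirchSwinnertonDyer.BirchSwinnertonDyer.Theorems.ManinLocalTwoThreeNegOneTwistIstarZeroExits
import HarnessLib

/-!
# S-an-63 «16 ∥ N descends», row `I₀*/8` — part 2: a curve of Kodaira type `I₀*` at `2` with `ord₂ Δ_min = 8` (`f₂ = 4`) has
# `χ₋₄`-twist of type `IV*` (`f₂ = 2`) or `I₁*` (`f₂ = 3`) — Barrios et al. 2025 Thm. 5.1, row I₀* (`v(a₃) = 2`), `d ≡ 3 (4)`, for `d = −1`
# (route `ManinLocalTwoThree`, crux C2 `ManinOddAtFour` stmt-BirchSwinnertonDyer-22967; cell bsd-f2-manin, an's candidate S-an-63; p3 gen 12)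

Assembly over the exits of part 1 (`…NegOneTwistIstarZeroExits`): normal form `[2α, 2p, 4γ, 4q, 8r]`
(`LocalIndex.exists_smul_of_kodairaSymbolOfMinimal_eq_Istar_zero`; `pq + r ∈ ℤ₂ˣ` by `isUnit_of_distinctRootCount_cubicStep6_eq_three`;
`α²q + γ² ∈ ℤ₂ˣ` from `ord Δ = 8` by `addVal_Δ_toNat_of_step6`), twist model (`quadraticTwist_negOne_map_of_IstarZeroForm`), the four residue
cases (`q̄ = 0`: `r, γ ∈ ℤ₂ˣ`; `q̄ = 1`: `p + r, α² + γ², γ + α ∈ ℤ₂ˣ` and `(α²+p) + (γ²+r)`, `q + 3`, `1 + q` even), Ogg's formula on the exit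
model (`conductorExponent_negTwist_of_exitModel`, p2's `key` block) with `ord₂ Δ = 8` unchanged: `f₂(W ⊗ (−1)) = 8 + 1 − 7 = 2` (IV*) or
`8 + 1 − 6 = 3` (I₁*), hence `≤ 3`.  With `…NegOneTwistTypeTwoFour` (row II/4) and `…ConductorExponentFourAtTwo` (the `f₂ = 4` list) this
settles the two largest `f₂ = 4` strata (II/4: 11 840, I₀*/8: 15 945 of Cremona's curves `N ≤ 10⁵`); rows I₂*/10, I₃*/11, I₄*/12, II*/12,
Iₙ≥5* remain for S-an-63.  HONEST FRAMING: a local theorem in print, kernel-checked; nothing about BSD or Manin's conjecture is proved; C2 OPEN.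
[cite: BarriosEtAl2025, Thm. 5.1 (arXiv:2501.03209 p. 16), row I₀*, (f, f^d) ∈ {(4,2),(4,3)}] [cite: SilvermanATAEC1994, IV.9.4 and IV.11.1]
-/

set_option autoImplicit false
-- lint-debt: the directory name repeats the summit name (sibling precedent `ManinLocalTwoThreeNegOneTwistConductorAtTwo.lean`)
set_option linter.dupNamespace false

noncomputable section

open scoped Classical
open Polynomial IsLocalRing WeierstrassCurve
open IsDiscreteValuationRing hiding maximalIdeal
open Literature.NumberTheory.DiophantineGeometry Literature.NumberTheory.DiophantineGeometry.TateAlgorithm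
  Literature.NumberTheory.DiophantineGeometry.TateAlgorithm.CharTwo

namespace Summit.BirchSwinnertonDyer.BirchSwinnertonDyer.Theorems.ManinLocalTwoThree

/-! ## §4 The global assembly: `I₀*` with `ord₂ Δ_min = 8` twists to `f₂ ∈ {2, 3}` -/

/-- Units of `ℤ₂` differ from units by even amounts: `u + 2y` is a unit. [folklore] -/
private theorem isUnit_add_two_mul {u : ℤ_[2]} (hu : IsUnit u) (y : ℤ_[2]) : IsUnit (u + 2 * y) := by
  have hirr : Irreducible (2 : ℤ_[2]) := by exact_mod_cast PadicInt.irreducible_p (p := 2)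
  exact isUnit_add_mul_of_isUnit hirr hu y

/-- The sum of two units of `ℤ₂` is even. [folklore] -/
private theorem two_dvd_add_of_isUnit {u w : ℤ_[2]} (hu : IsUnit u) (hw : IsUnit w) : (2 : ℤ_[2]) ∣ u + w := by
  obtain ⟨x, hx⟩ := exists_eq_one_add_two_mul_of_isUnit_padicInt hu
  obtain ⟨y, hy⟩ := exists_eq_one_add_two_mul_of_isUnit_padicInt hw
  exact ⟨1 + x + y, by rw [hx, hy]; ring⟩

/-- **S-an-63, row `I₀*/8`** (Barrios et al. 2025 Thm. 5.1, row I₀* with `v(a₃) = 2`, `d ≡ 3 (4)`, kernel-checked for `d = −1`): if `W/ℚ` is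
of Kodaira type `I₀*` at `2` with `ord₂ Δ_min = 8` (the `f₂ = 4` stratum of type `I₀*`), then `f₂(W ⊗ (−1)) = 2` (type `IV*`) or
`f₂(W ⊗ (−1)) = 3` (type `I₁*`).  Normal form `[2α, 2p, 4γ, 4q, 8r]` with `pq + r`, `α²q + γ²` units
(`LocalIndex.exists_smul_of_kodairaSymbolOfMinimal_eq_Istar_zero`, `isUnit_of_distinctRootCount_cubicStep6_eq_three`,
`addVal_Δ_toNat_of_step6`); twist `[0, −(α²+2p), 0, 4(q+αγ), −4(γ²+2r)]`; exit model `T″ = (1, 0, α, 2γ) • T = [2α, −2(α²+p), 4γ, 4q,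
−8(γ²+r)]`, again Step-6 normalised with INSEPARABLE cubic (`p′q + r′ ≡ (α²q+γ²) + (pq+r) ≡ 0`); the four residue cases give
IV* (§3 A0/A1, Step 8, after `x ↦ x + 2` when the triple root is `1`) or I₁* (§3 B0/B1, Step 7 round `0`); Ogg on the exit model
with `ord₂ Δ = 8` unchanged: `f = 8 + 1 − 7 = 2` or `8 + 1 − 6 = 3`.
[cite: BarriosEtAl2025, Thm. 5.1 (arXiv:2501.03209 p. 16), row I₀*, (f, f^d) ∈ {(4,2),(4,3)}] [cite: SilvermanATAEC1994, IV.9.4 and IV.11.1] -/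
theorem conductorExponent_quadraticTwist_negOne_of_IstarZero_eight (W : WeierstrassCurve ℚ) [W.IsElliptic]
    (hK : W.kodairaSymbolAt ((Rat.HeightOneSpectrum.primesEquiv (R := ℤ)).symm ⟨2, Nat.prime_two⟩) = .Istar 0)
    (hord : W.ordMinimalDiscriminant ((Rat.HeightOneSpectrum.primesEquiv (R := ℤ)).symm ⟨2, Nat.prime_two⟩) = 8) :
    (W.quadraticTwist ((-1 : ℤ) : ℚ)).conductorExponent ((Rat.HeightOneSpectrum.primesEquiv (R := ℤ)).symm ⟨2, Nat.prime_two⟩) = 2 ∨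
    (W.quadraticTwist ((-1 : ℤ) : ℚ)).conductorExponent ((Rat.HeightOneSpectrum.primesEquiv (R := ℤ)).symm ⟨2, Nat.prime_two⟩) = 3 := by
  haveI : Fact (Nat.Prime 2) := ⟨Nat.prime_two⟩
  haveI : Finite (ResidueField ℤ_[2]) := Finite.of_equiv _ (PadicInt.residueField (p := 2)).toEquiv.symm
  have hirr : Irreducible (2 : ℤ_[2]) := by exact_mod_cast PadicInt.irreducible_p (p := 2)
  set v : IsDedekindDomain.HeightOneSpectrum ℤ := (Rat.HeightOneSpectrum.primesEquiv (R := ℤ)).symm ⟨2, Nat.prime_two⟩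
    with hvdef
  have e : Rat.HeightOneSpectrum.primesEquiv (R := ℤ) v = ⟨2, Nat.prime_two⟩ := Equiv.apply_symm_apply _ _
  -- Kodaira `I₀*` and `ord Δ_min = 8`, read over `ℤ₂`
  have hKp := WeierstrassCurve.kodairaSymbolAt_eq_padic (R := ℤ) v W
  rw [e] at hKp
  change W.kodairaSymbolAt v = (((W.baseChange ℚ_[2]).minimal ℤ_[2]).integralModel ℤ_[2]).kodairaSymbolOfMinimal at hKp
  have hOp := WeierstrassCurve.ordMinimalDiscriminant_eq_padic (R := ℤ) v W
  rw [e] at hOp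
  change W.ordMinimalDiscriminant v =
    (IsDiscreteValuationRing.addVal ℤ_[2] (((W.baseChange ℚ_[2]).minimal ℤ_[2]).integralModel ℤ_[2]).Δ).toNat at hOp
  set X : WeierstrassCurve ℚ_[2] := W.baseChange ℚ_[2] with hX
  set V₀ : WeierstrassCurve ℤ_[2] := (X.minimal ℤ_[2]).integralModel ℤ_[2] with hV₀
  set E : VariableChange ℚ_[2] := (X.exists_isMinimal ℤ_[2]).choose with hE
  have hmin : X.minimal ℤ_[2] = E • X := rfl
  have hV₀X : V₀.baseChange ℚ_[2] = X.minimal ℤ_[2] := WeierstrassCurve.baseChange_integralModel_eq ℤ_[2] _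
  rw [hK] at hKp
  rw [hord] at hOp
  have hΔ0 : V₀.Δ ≠ 0 := by
    intro h0; rw [h0] at hOp; simp at hOp
  -- the twist over `ℚ₂`
  have hd0 : ((-1 : ℤ) : ℚ) ≠ 0 := by norm_num
  haveI := W.isElliptic_quadraticTwist hd0
  set Xm : WeierstrassCurve ℚ_[2] := (W.quadraticTwist ((-1 : ℤ) : ℚ)).baseChange ℚ_[2] with hXm
  have hXmX : Xm = X.quadraticTwist (-1) := by
    rw [hXm, hX, WeierstrassCurve.baseChange, WeierstrassCurve.baseChange, WeierstrassCurve.map_quadraticTwist]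
    simp
  -- `Δ` of a twist model equals `Δ` of the normal form
  have hΔtw : ∀ (D : VariableChange ℤ_[2]) (T : WeierstrassCurve ℤ_[2]),
      ((D • V₀).map (algebraMap ℤ_[2] ℚ_[2])).quadraticTwist (-1) = T.map (algebraMap ℤ_[2] ℚ_[2]) → T.Δ = (D • V₀).Δ := by
    intro D T hNT
    have hΔT : (T.Δ : ℚ_[2]) = ((D • V₀).Δ : ℚ_[2]) := by
      have h1 : (T.map (algebraMap ℤ_[2] ℚ_[2])).Δ = (((D • V₀).map (algebraMap ℤ_[2] ℚ_[2])).quadraticTwist (-1)).Δ := by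
        rw [hNT]
      rw [WeierstrassCurve.map_Δ, WeierstrassCurve.quadraticTwist_Δ, WeierstrassCurve.map_Δ] at h1
      norm_num at h1
      exact h1
    exact IsFractionRing.injective ℤ_[2] ℚ_[2] hΔT
  -- common step: from a normal form `N = D • V₀` and a twist model `T` to the exit model `C₆ • T`
  have key : ∀ (D : VariableChange ℤ_[2]) (T : WeierstrassCurve ℤ_[2]) (C₆ : VariableChange ℤ_[2]),
      ((D • V₀).map (algebraMap ℤ_[2] ℚ_[2])).quadraticTwist (-1) = T.map (algebraMap ℤ_[2] ℚ_[2]) →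
      (C₆ • T).kodairaSymbolOfMinimal ≠ .I 0 →
      (W.quadraticTwist ((-1 : ℤ) : ℚ)).conductorExponent v =
        (IsDiscreteValuationRing.addVal ℤ_[2] V₀.Δ).toNat + 1 - (C₆ • T).kodairaSymbolOfMinimal.numComponents := by
    intro D T C₆ hNT hne
    set Ctot : VariableChange ℚ_[2] := D.map (algebraMap ℤ_[2] ℚ_[2]) * E with hCtot
    have hCX : Ctot • X = (D • V₀).map (algebraMap ℤ_[2] ℚ_[2]) := by
      rw [hCtot, mul_smul, ← hmin, ← hV₀X]
      exact WeierstrassCurve.map_variableChange _ _ _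
    set C₁ : VariableChange ℚ_[2] := ⟨Ctot.u, (-1) * Ctot.r, 0, 0⟩ with hC₁
    have hT : T.map (algebraMap ℤ_[2] ℚ_[2]) = C₁ • Xm := by
      rw [← hNT, ← hCX, WeierstrassCurve.quadraticTwist_smul, hXmX]
    have hT' : (C₆ • T).map (algebraMap ℤ_[2] ℚ_[2]) = (C₆.map (algebraMap ℤ_[2] ℚ_[2]) * C₁) • Xm := by
      rw [mul_smul, ← hT]
      exact (WeierstrassCurve.map_variableChange _ _ _).symm
    rw [conductorExponent_negTwist_of_exitModel W (C₆ • T) _ hT' hne, addVal_Δ_smul_toNat, hΔtw D T hNT, addVal_Δ_smul_toNat]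
  -- the `I₀*/8` normal form with unit witnesses
  obtain ⟨D, h₁, h₂, h₃, h₄, h₆, h3⟩ :=
    Literature.NumberTheory.EllipticCurves.LocalIndex.exists_smul_of_kodairaSymbolOfMinimal_eq_Istar_zero V₀ hΔ0 hKp.symm
  have hm : ∀ {x : ℤ_[2]}, x ∈ maximalIdeal ℤ_[2] ↔ (2 : ℤ_[2]) ∣ x := fun {x} ↦ mem_maximalIdeal_iff_dvd_of_irreducible hirr x
  have hmn : ∀ {x : ℤ_[2]} {n : ℕ}, x ∈ maximalIdeal ℤ_[2] ^ n ↔ (2 : ℤ_[2]) ^ n ∣ x := fun {x n} ↦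
    mem_maximalIdeal_pow_iff_dvd_of_irreducible hirr x n
  obtain ⟨α, hα⟩ := hm.mp h₁
  obtain ⟨p, hp⟩ := hm.mp h₂
  obtain ⟨γ, hγ⟩ := hmn.mp h₃
  obtain ⟨q, hq⟩ := hmn.mp h₄
  obtain ⟨r, hr⟩ := hmn.mp h₆
  have hI : IsUnit (p * q + r) := isUnit_of_distinctRootCount_cubicStep6_eq_three hirr hp hq hr h3
  have hΔN : (IsDiscreteValuationRing.addVal ℤ_[2] (D • V₀).Δ).toNat = 8 := by rw [addVal_Δ_smul_toNat, ← hOp]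
  have h8u : IsUnit (α ^ 2 * q + γ ^ 2) := by
    obtain ⟨-, h9, h10⟩ := addVal_Δ_toNat_of_step6 hirr (D • V₀) hα hp hγ hq hr hI
    by_contra hnu
    by_cases hαu : IsUnit α
    · have := h9 hnu hαu; omega
    · have := h10 hnu hαu; omega
  -- the twist model and its discriminant
  have hNT := quadraticTwist_negOne_map_of_IstarZeroForm (D • V₀) hα hp hγ hq hr
  set T : WeierstrassCurve ℤ_[2] := ⟨0, -(α ^ 2 + 2 * p), 0, 4 * (q + α * γ), -(4 * (γ ^ 2 + 2 * r))⟩ with hTdef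
  have hΔ8 : (IsDiscreteValuationRing.addVal ℤ_[2] ((⟨1, 0, α, 2 * γ⟩ : VariableChange ℤ_[2]) • T).Δ).toNat = 8 := by
    rw [addVal_Δ_smul_toNat, hΔtw D T hNT, hΔN]
  -- four residue cases
  by_cases hq2 : (2 : ℤ_[2]) ∣ q
  · -- `q̄ = 0`: `r`, `γ` are units
    obtain ⟨q₂, hq₂⟩ := hq2
    have hru : IsUnit r := by
      have := isUnit_add_two_mul hI (-(p * q₂))
      convert this using 1; rw [hq₂]; ring
    have hγu : IsUnit γ := by
      have h2 : IsUnit (γ ^ 2) := by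
        have := isUnit_add_two_mul h8u (-(α ^ 2 * q₂))
        convert this using 1; rw [hq₂]; ring
      exact (isUnit_pow_iff two_ne_zero).mp h2
    have hR : (2 : ℤ_[2]) ∣ γ ^ 2 + r := two_dvd_add_of_isUnit (hγu.pow 2) hru
    by_cases hP : (2 : ℤ_[2]) ∣ α ^ 2 + p
    · -- A0: IV*
      have hexit := kodairaSymbolOfMinimal_negTwist_IstarZero_IVstar hP ⟨q₂, hq₂⟩ hR hγu
      left
      rw [key D T ⟨1, 0, α, 2 * γ⟩ hNT (by rw [hexit]; decide), hexit, ← hOp]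
      rfl
    · -- B0: I₁*
      have hexit := kodairaSymbolOfMinimal_negTwist_IstarZero_IstarOne hP ⟨q₂, hq₂⟩ hR hγu hΔ8
      right
      rw [key D T ⟨1, 0, α, 2 * γ⟩ hNT (by rw [hexit]; decide), hexit, ← hOp]
      rfl
  · -- `q̄ = 1`: `p + r`, `α² + γ²`, `γ + α` are units; `(α²+p) + (γ²+r)` and `q + 3`, `1 + q` are even
    have hqu : IsUnit q := (isUnit_iff_not_dvd hirr _).mpr hq2
    obtain ⟨θ, hθ⟩ := exists_eq_one_add_two_mul_of_isUnit_padicInt hqu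
    have hpr : IsUnit (p + r) := by
      have := isUnit_add_two_mul hI (-(θ * p))
      convert this using 1; rw [hθ]; ring
    have hαγ : IsUnit (α ^ 2 + γ ^ 2) := by
      have := isUnit_add_two_mul h8u (-(θ * α ^ 2))
      convert this using 1; rw [hθ]; ring
    have hu : IsUnit (γ + α) := by
      have h2 : IsUnit ((γ + α) ^ 2) := by
        have := isUnit_add_two_mul hαγ (α * γ)
        convert this using 1; ring
      exact (isUnit_pow_iff two_ne_zero).mp h2
    have hsum : (2 : ℤ_[2]) ∣ (α ^ 2 + p) + (γ ^ 2 + r) := by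
      have := two_dvd_add_of_isUnit hαγ hpr
      convert this using 1; ring
    have h4 : (2 : ℤ_[2]) ∣ q + 3 - 2 * (α ^ 2 + p) := ⟨2 + θ - (α ^ 2 + p), by rw [hθ]; ring⟩
    have h1q : (2 : ℤ_[2]) ∣ 1 + q := ⟨1 + θ, by rw [hθ]; ring⟩
    have h6 : (2 : ℤ_[2]) ∣ 1 + q - (α ^ 2 + p) - (γ ^ 2 + r) := by
      have := dvd_sub h1q hsum
      convert this using 1; ring
    by_cases hP : (2 : ℤ_[2]) ∣ α ^ 2 + p
    · -- B1: I₁*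
      have hR : (2 : ℤ_[2]) ∣ γ ^ 2 + r := by
        have := dvd_sub hsum hP
        convert this using 1; ring
      have hexit := kodairaSymbolOfMinimal_negTwist_IstarZero_IstarOne' hP hq2 hR h4 h6 hu hΔ8
      right
      rw [key D T ⟨1, 0, α, 2 * γ⟩ hNT (by rw [hexit]; decide), hexit, ← hOp]
      rfl
    · -- A1: IV* on `(1, 2, 0, 0) • T″`
      have hPu : IsUnit (α ^ 2 + p) := (isUnit_iff_not_dvd hirr _).mpr hP
      obtain ⟨z, hz⟩ := exists_eq_one_add_two_mul_of_isUnit_padicInt hPu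
      have h2 : (2 : ℤ_[2]) ∣ 3 - (α ^ 2 + p) := ⟨1 - z, by rw [hz]; ring⟩
      have hexit := kodairaSymbolOfMinimal_negTwist_IstarZero_IVstar' h2 h4 h6 hu
      left
      have hexit' : (((⟨1, 2, 0, 0⟩ : VariableChange ℤ_[2]) * ⟨1, 0, α, 2 * γ⟩) • T).kodairaSymbolOfMinimal = .IVstar := by
        rw [mul_smul]; exact hexit
      rw [key D T ((⟨1, 2, 0, 0⟩ : VariableChange ℤ_[2]) * ⟨1, 0, α, 2 * γ⟩) hNT (by rw [hexit']; decide), hexit', ← hOp]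
      rfl

/-- **S-an-63, row `I₀*/8`, in the `≤ 3` form.** [cite: BarriosEtAl2025, Thm. 5.1 (arXiv:2501.03209 p. 16), row I₀*] -/
theorem conductorExponent_quadraticTwist_negOne_le_three_of_IstarZero_eight (W : WeierstrassCurve ℚ) [W.IsElliptic]
    (hK : W.kodairaSymbolAt ((Rat.HeightOneSpectrum.primesEquiv (R := ℤ)).symm ⟨2, Nat.prime_two⟩) = .Istar 0)
    (hord : W.ordMinimalDiscriminant ((Rat.HeightOneSpectrum.primesEquiv (R := ℤ)).symm ⟨2, Nat.prime_two⟩) = 8) :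
    (W.quadraticTwist ((-1 : ℤ) : ℚ)).conductorExponent ((Rat.HeightOneSpectrum.primesEquiv (R := ℤ)).symm ⟨2, Nat.prime_two⟩) ≤ 3 := by
  rcases conductorExponent_quadraticTwist_negOne_of_IstarZero_eight W hK hord with h | h <;> omega

end Summit.BirchSwinnertonDyer.BirchSwinnertonDyer.Theorems.ManinLocalTwoThree

end
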